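import Literature.NumberTheory.Sieve.HeathBrownCubicGrossen
import Literature.NumberTheory.Sieve.HeathBrownCubicTwistedClasses
import Literature.NumberTheory.LFunctions.TwistedDedekindCoefficients
import HarnessLib

/-!
# Partial sums of Heath-Brown's Grössencharaktere `ν^{(j,k)}` over the ideals of `ℤ[∛2]`

The bridge between the ideal-theoretic characters `grossenChar hq χ j k = ν₀ν₁^jν₂^k`
(`HeathBrownCubicGrossen`, (9.2) of D. R. Heath-Brown, *Primes represented by `x³ + 2y³`*, Acta Math.
186 (2001)) and the lattice sums of torus characters `ψ_{j,κ}` over canonical generators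
(`HeathBrownCubicTwistedCount`, `HeathBrownCubicTwistedClasses`), ending in the **power-saving bound
for the partial sums of a non-trivial `ν^{(j,k)}`** that replaces Hecke's theory of Grössencharakter
`L`-functions in the continuation of `L(s, ν)` (T. Mitsui, Jap. J. Math. 26 (1956), Lemma 5 =
Heath-Brown's Lemma 9.4). Everything is PROVED; the definitions (`canonT`, `canonGen`, `kappaOf`,
`normTwist`, `idealsUpTo`, `latticeGens`, `reps`, `redMod`, `normPhase`, `thetaOf`) have bodies.

* **Canonical generators** (`canonGen S`: the unique generator with `N(S)^{1/3} < β ≤ ε·N(S)^{1/3}`,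
  from the window of `HeathBrownCubicWindow`; `span_canonGen`, `inWindow_canonGen`,
  `canonGen_span_eq_of_inWindow`), and the dictionary window ⟷ polar fundamental region:
  `embW_realVec_mem_smul_iff`: `embW β̂ ∈ t·F ↔ InWindow (N^{1/3}) β ∧ N((β)) ≤ t³`
  (`F = sectorIoc (0,−π) (1,π)`), whence `mem_latticeGens_iff` and the re-indexing
  `sum_idealsUpTo_eq_sum_latticeGens : ∑_{0<N(I)≤t³} f(I) = ∑_{v ∈ latticeGens t} f((coordElt v))`.
* **The character formula** `nuO_eq_charW` (`β > 0`):
  `ν₀ν₁^jν₂^k(β) = χ(β) · ψ_{j,κ}(embW β̂) · N(β)^{−iΘ}` with `κ = kappaOf χ j k = k + (ju + t_χ)/2π`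
  and `Θ = thetaOf = 2πκ/(3 log ε)` (`log β/log ε = r + log N/(3 log ε)`, `log_div_unitLog_eq`);
  `|κ| ≤ |k| + |j| + 1`.
* **Residue classes**: `reps q ≃ 𝓞_K/(q)` through `coordElt` (`injOn_toQuotMod_coordElt`,
  `exists_reps_toQuotMod_eq`), `χ` is a class function (`toQuotMod_coordElt_eq`), orthogonality
  `sum_reps_mulChar_eq_zero` (`χ ≠ χ₀`), and the class splitting `sum_eq_sum_reps_filter`.
* **`sum_grossenChar_mul_normPhase_eq`**:
  `∑_{0<N(I)≤t³} ν(I)N(I)^{iΘ} = ∑_{a ∈ reps q} χ(coordElt a) ∑_{v ∈ T(a)} ψ_{j,κ}(embW v̂)`.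
* **`exists_grossenChar_partialSum_bound`**: ONE absolute `C` with
  `‖∑_{0<N(I)≤t³} ν(I) N(I)^{iΘ}‖ ≤ C q³ (1 + |j| + |k|) t^{8/3}` (`x^{8/9}`, `x = t³`) for every
  `q ≥ 1`, `χ`, `j`, `k` with `ν^{(j,k)}` not trivial `mod q` and every `t ≥ 1`: by
  `params_of_not_isTrivialMod`, either `χ ≠ χ₀` (orthogonality against the class-independent main
  term of `exists_twisted_sum_approx`) or the torus character is non-trivial on every class
  (`exists_twisted_sum_bound`).

## References

* D. R. Heath-Brown, *Primes represented by `x³ + 2y³`*, Acta Math. 186 (2001), §9 (9.2), p. 54,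
  Lemma 9.4; §11 (11.3). [cite: HeathBrownActa2001, §9 (9.2)]
* T. Mitsui, *Generalized prime number theorem*, Jap. J. Math. 26 (1956), 1–42, Lemma 5. [cite: Mitsui1956, Lemma 5]
* E. Hecke, *Eine neue Art von Zetafunktionen …* II, Math. Z. 6 (1920), 11–51. [folklore]

## Mathlib / tree search

Tree: `HeathBrownCubicGrossen` (`nuO`, `nu0O`, `nu1`, `nu2`, `realVec`, `grossenChar_span`, `idealGen`,
`unitArg`, `unitLog`, `charAngle`, `charAngle_one`, `isTrivialMod_grossenChar_one`, `finite_quotMod`,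
`norm_mulChar_apply_units`, `cplxEmb_ne_zero_of_normForm_ne_zero`, `coordVec_zero'`),
`HeathBrownCubicWindow` (`InWindow`, `exists_associated_inWindow`, `eq_of_associated_of_inWindow`,
`abs_normForm_coordVec`), `HeathBrownCubicCubeSums` (`natCast_dvd_coordElt_iff`, `coordElt_sub`),
`HeathBrownCubicTwistedCount/Classes` (`CongMod`, `sectorIoc`, `charW`, `mem_sectorIoc_iff`, `wR_smul`,
`wNorm_smul`, `pos_of_mem_smul_fundRegion`, `exists_twisted_sum_bound`, `exists_twisted_sum_approx`),
`LFunctions.NumberField.idealsOfNorm`. Mathlib: `MulChar.sum_eq_zero_of_ne_one`, `Finset.sum_nbij`,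
`Finset.sum_fiberwise_of_maps_to`, `Int.modEq_iff_dvd`, `Ideal.Quotient.eq`, `Complex.norm_mul_exp_arg_mul_I`,
`Complex.exp_int_mul`. (`HeathBrownCubicGrossenTrivial.isTrivialMod_iff` proves more than
`params_of_not_isTrivialMod`; only the easy direction is needed here.)
-/

noncomputable section

open NumberField Finset Complex Set
open scoped Pointwise

namespace Literature.NumberTheory.Sieve.CubicSieve

open LFunctions.CubeRootTwoField CubicPrimes

/-! ### Canonical generators: the window `N(S)^{1/3} < β ≤ E·N(S)^{1/3}` -/

/-- `CongMod q a` is decidable. [folklore] -/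
instance instDecidablePredCongMod (q : ℕ) (a : ℤ × ℤ × ℤ) : DecidablePred (CongMod q a) :=
  fun v ↦ by unfold CongMod; infer_instance

/-- `T(S) = N(S)^{1/3}`, the scale of the window of the ideal `S`. [cite: HeathBrownActa2001, §11 (11.3)] -/
def canonT (S : Ideal (𝓞 K)) : ℝ := (Ideal.absNorm S : ℝ) ^ ((1 : ℝ) / 3)

/-- `T(S) > 0` for `S ≠ 0`. [folklore] -/
theorem canonT_pos {S : Ideal (𝓞 K)} (hS : S ≠ ⊥) : 0 < canonT S := by
  have : 0 < (Ideal.absNorm S : ℝ) := by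
    have h := Ideal.absNorm_eq_zero_iff.not.2 hS
    positivity
  exact Real.rpow_pos_of_pos this _

/-- `T(S)³ = N(S)`. [folklore] -/
theorem canonT_pow_three (S : Ideal (𝓞 K)) : canonT S ^ 3 = (Ideal.absNorm S : ℝ) := by
  rw [canonT, ← Real.rpow_natCast, ← Real.rpow_mul (by positivity)]; norm_num

/-- **The canonical generator** of a non-zero ideal `S`: the unique generator `β` with
`N(S)^{1/3} < β ≤ E·N(S)^{1/3}` in the real embedding (`InWindow (canonT S) β`; `0` for `S = 0`).
[cite: HeathBrownActa2001, §11 (11.3)] -/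
def canonGen (S : Ideal (𝓞 K)) : 𝓞 K := by
  classical
  exact if hS : S = ⊥ then 0 else
    ((Classical.choose (exists_associated_inWindow (canonT_pos hS) (idealGen_ne_zero hS)) : (𝓞 K)ˣ) :
      𝓞 K) * idealGen S

/-- The canonical generator generates. [folklore] -/
theorem span_canonGen (S : Ideal (𝓞 K)) : Ideal.span {canonGen S} = S := by
  classical
  by_cases hS : S = ⊥
  · rw [hS, canonGen, dif_pos rfl, Ideal.span_singleton_eq_bot.2 rfl]
  · rw [canonGen, dif_neg hS, Ideal.span_singleton_mul_left_unit (Units.isUnit _), span_idealGen]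

/-- The canonical generator lies in its window. [folklore] -/
theorem inWindow_canonGen {S : Ideal (𝓞 K)} (hS : S ≠ ⊥) : InWindow (canonT S) (canonGen S) := by
  classical
  rw [canonGen, dif_neg hS]
  exact Classical.choose_spec (exists_associated_inWindow (canonT_pos hS) (idealGen_ne_zero hS))

/-- The canonical generator of a non-zero ideal is non-zero. [folklore] -/
theorem canonGen_ne_zero {S : Ideal (𝓞 K)} (hS : S ≠ ⊥) : canonGen S ≠ 0 := by
  intro h
  apply hS
  rw [← span_canonGen S, h, Ideal.span_singleton_eq_bot.2 rfl]

/-- **Uniqueness**: a generator in the window of its ideal IS the canonical generator. [folklore] -/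
theorem canonGen_span_eq_of_inWindow {β : 𝓞 K} (hβ : β ≠ 0)
    (h : InWindow (canonT (Ideal.span {β})) β) : canonGen (Ideal.span {β}) = β := by
  have hS : Ideal.span {β} ≠ ⊥ := by rwa [Ne, Ideal.span_singleton_eq_bot]
  have hgen := span_canonGen (Ideal.span {β})
  rw [Ideal.span_singleton_eq_span_singleton] at hgen
  obtain ⟨u, hu⟩ := hgen.symm
  -- `β * u = canonGen`, both in the same window
  have hT := canonT_pos hS
  have h2 : InWindow (canonT (Ideal.span {β})) ((u : 𝓞 K) * β) := by
    rw [mul_comm, hu]; exact inWindow_canonGen hS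
  rw [← hu, mul_comm]
  exact eq_of_associated_of_inWindow hT u h h2

/-! ### The window as membership in the scaled fundamental region -/

/-- `N(β̂) = N((β))` for `β > 0` in the real embedding (then `N(β̂) = β|β'|² > 0`). [folklore] -/
theorem normForm_realVec_eq_absNorm {β : 𝓞 K} (h : 0 < ellO β) :
    normForm (realVec β) = (Ideal.absNorm (Ideal.span {β}) : ℝ) := by
  rw [realVec, ← abs_normForm_coordVec, abs_of_nonneg]
  rw [← ell_mul_quadQ, ← normSq_cplxEmb]
  exact mul_nonneg h.le (Complex.normSq_nonneg _)

/-- `wNorm (embW β̂) = N((β))` for `β > 0`. [folklore] -/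
theorem wNorm_embW_realVec {β : 𝓞 K} (h : 0 < ellO β) :
    wNorm (embW (realVec β)) = (Ideal.absNorm (Ideal.span {β}) : ℝ) := by
  rw [wNorm_embW, normForm_realVec_eq_absNorm h]

/-- `wU (embW β̂) = T((β))` for `β > 0`. [folklore] -/
theorem wU_embW_realVec {β : 𝓞 K} (h : 0 < ellO β) :
    wU (embW (realVec β)) = canonT (Ideal.span {β}) := by
  rw [wU, wNorm_embW_realVec h, canonT]

/-- The second coordinate of `embW β̂` is non-zero for `β ≠ 0`. [folklore] -/
theorem embW_realVec_snd_ne_zero {β : 𝓞 K} (hβ : β ≠ 0) : (embW (realVec β)).2 ≠ 0 := by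
  rw [embW_apply]
  exact cplxEmb_ne_zero_of_normForm_ne_zero (normForm_realVec_ne_zero hβ)

/-- **Window ⟺ unit coordinate in `(0,1]`**: for `β > 0`, `r(embW β̂) ∈ (0, 1]` iff
`InWindow (canonT (β)) β`. [cite: HeathBrownActa2001, §11 (11.3)] -/
theorem wR_mem_Ioc_iff_inWindow {β : 𝓞 K} (h : 0 < ellO β) :
    wR (embW (realVec β)) ∈ Set.Ioc (0 : ℝ) 1 ↔ InWindow (canonT (Ideal.span {β})) β := by
  have hβ : β ≠ 0 := by
    rintro rfl
    rw [← ell_realVec, realVec, coordVec_zero'] at h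
    simp [castVec, ell] at h
  have hT : 0 < canonT (Ideal.span {β}) := canonT_pos (by rwa [Ne, Ideal.span_singleton_eq_bot])
  have hE := one_lt_unitE
  have hlogE := log_unitE_pos
  rw [wR, wU_embW_realVec h, embW_apply]
  change Real.log (ellO β / canonT (Ideal.span {β})) / Real.log unitE ∈ Set.Ioc (0 : ℝ) 1 ↔ _
  rw [InWindow, Set.mem_Ioc, lt_div_iff₀ hlogE, div_le_iff₀ hlogE, zero_mul, one_mul,
    Real.log_pos_iff (div_pos h hT).le, one_lt_div hT,
    Real.log_le_log_iff (div_pos h hT) (by linarith), div_le_iff₀ hT]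

/-- **Membership of `embW β̂` in `t·F`** (`F = sectorIoc (0,−π) (1,π)`, `t > 0`, `β ≠ 0`):
iff `β` is in the window of its ideal and `N((β)) ≤ t³`. [cite: HeathBrownActa2001, §11 (11.3)] -/
theorem embW_realVec_mem_smul_iff {t : ℝ} (ht : 0 < t) {β : 𝓞 K} (hβ : β ≠ 0) :
    embW (realVec β) ∈ t • sectorIoc ((0 : ℝ), -Real.pi) (1, Real.pi) ↔
      InWindow (canonT (Ideal.span {β})) β ∧ (Ideal.absNorm (Ideal.span {β}) : ℝ) ≤ t ^ 3 := by
  rw [Set.mem_smul_set_iff_inv_smul_mem₀ ht.ne', mem_sectorIoc_iff le_rfl le_rfl]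
  have h2 := embW_realVec_snd_ne_zero hβ
  have ht' : 0 < t⁻¹ := inv_pos.2 ht
  constructor
  · rintro ⟨h1, -, hN, hr, -⟩
    have hell : 0 < ellO β := by
      have : 0 < t⁻¹ * ell (realVec β) := by simpa using h1
      exact pos_of_mul_pos_right this ht'.le
    rw [wR_smul ht' (show 0 < (embW (realVec β)).1 from hell) h2, wR_mem_Ioc_iff_inWindow hell] at hr
    refine ⟨hr, ?_⟩
    rw [wNorm_smul, wNorm_embW_realVec hell, inv_pow] at hN
    rwa [inv_mul_le_iff₀ (pow_pos ht 3), mul_one] at hN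
  · rintro ⟨hw, hN⟩
    have hell : 0 < ellO β := (canonT_pos (by rwa [Ne, Ideal.span_singleton_eq_bot])).trans hw.1
    have h1 : 0 < (embW (realVec β)).1 := hell
    refine ⟨by simpa using mul_pos ht' h1, ?_, ?_, ?_, ?_⟩
    · simpa [Complex.real_smul] using mul_ne_zero (Complex.ofReal_ne_zero.2 ht'.ne') h2
    · rw [wNorm_smul, wNorm_embW_realVec hell, inv_pow, inv_mul_le_iff₀ (pow_pos ht 3), mul_one]
      exact hN
    · rw [wR_smul ht' h1 h2, wR_mem_Ioc_iff_inWindow hell]; exact hw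
    · rw [arg_smul_snd ht']; exact Complex.arg_mem_Ioc _

/-! ### Heath-Brown's `ν^{(j,k)}` through the torus characters `ψ_{j,κ}` -/

variable {q : ℕ}

/-- **The unit frequency** of `ν^{(j,k)} = ν₀ν₁^jν₂^k`: `κ = k + (ju + t_χ)/(2π)` (`u = arg ε'`,
`χ(ε) = e^{it_χ}`), so that the `log β`-dependence of `ν` is `e^{−2πiκ·log β/log ε}`.
[cite: HeathBrownActa2001, §9 (9.2)] -/
def kappaOf (χ : MulChar (QuotMod q) ℂ) (j k : ℤ) : ℝ :=
  k + (j * unitArg + charAngle χ) / (2 * Real.pi)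

/-- `|κ| ≤ |k| + |j| + 1` (`|u|, |t_χ| ≤ π`). [folklore] -/
theorem abs_kappaOf_le (χ : MulChar (QuotMod q) ℂ) (j k : ℤ) :
    |kappaOf χ j k| ≤ |(k : ℝ)| + |(j : ℝ)| + 1 := by
  rw [kappaOf]
  have hu : |unitArg| ≤ Real.pi := Complex.abs_arg_le_pi _
  have ht : |charAngle χ| ≤ Real.pi := abs_charAngle_le χ
  have hπ := Real.pi_pos
  have hX : |((j : ℝ) * unitArg + charAngle χ) / (2 * Real.pi)| ≤ |(j : ℝ)| + 1 := by
    rw [abs_div, abs_of_pos (by positivity : (0 : ℝ) < 2 * Real.pi), div_le_iff₀ (by positivity)]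
    calc |(j : ℝ) * unitArg + charAngle χ| ≤ |(j : ℝ) * unitArg| + |charAngle χ| := abs_add_le _ _
      _ = |(j : ℝ)| * |unitArg| + |charAngle χ| := by rw [abs_mul]
      _ ≤ |(j : ℝ)| * Real.pi + Real.pi := by gcongr
      _ ≤ (|(j : ℝ)| + 1) * (2 * Real.pi) := by nlinarith [abs_nonneg (j : ℝ)]
  calc |(k : ℝ) + ((j : ℝ) * unitArg + charAngle χ) / (2 * Real.pi)|
      ≤ |(k : ℝ)| + |((j : ℝ) * unitArg + charAngle χ) / (2 * Real.pi)| := abs_add_le _ _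
    _ ≤ |(k : ℝ)| + (|(j : ℝ)| + 1) := by gcongr
    _ = _ := by ring

/-- **The norm twist** `N(w)^{−2πiκ/(3 log ε)} = exp(−2πiκ · log N(w)/(3 log ε))`. [folklore] -/
def normTwist (κ : ℝ) (w : ℝ × ℂ) : ℂ :=
  Complex.exp (((-(2 * Real.pi * κ * (Real.log (wNorm w) / (3 * unitLog)))) : ℝ) * I)

/-- `|normTwist| = 1`. [folklore] -/
theorem norm_normTwist (κ : ℝ) (w : ℝ × ℂ) : ‖normTwist κ w‖ = 1 := by
  rw [normTwist, Complex.norm_exp_ofReal_mul_I]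

/-- `log β / log ε = r(w) + log N(w)/(3 log ε)` for `w = embW β̂`, `β > 0` (`N = β·|β'|²`,
`u(w) = N^{1/3}`). [folklore] -/
theorem log_div_unitLog_eq {w : ℝ × ℂ} (h1 : 0 < w.1) (h2 : w.2 ≠ 0) :
    Real.log w.1 / unitLog = wR w + Real.log (wNorm w) / (3 * unitLog) := by
  have hN := wNorm_pos h1 h2
  have hU := wU_pos h1 h2
  have hlogU : Real.log (wU w) = Real.log (wNorm w) / 3 := by
    rw [wU, Real.log_rpow hN]; ring
  rw [wR, Real.log_div h1.ne' hU.ne', hlogU, unitLog]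
  field_simp
  ring

/-- **`ν^{(j,k)}(β) = χ(β) · ψ_{j,κ}(embW β̂) · N^{−2πiκ/(3 log ε)}`** for `β > 0` in the real embedding,
with `κ = kappaOf χ j k`: Heath-Brown's character is the residue character times a torus character
times a norm twist. [cite: HeathBrownActa2001, §9 (9.2)] -/
theorem nuO_eq_charW (χ : MulChar (QuotMod q) ℂ) (j k : ℤ) {β : 𝓞 K} (h : 0 < ellO β) :
    nuO χ j k β = χ (toQuotMod q β) * charW j (kappaOf χ j k) (embW (realVec β)) *
      normTwist (kappaOf χ j k) (embW (realVec β)) := by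
  have hβ : β ≠ 0 := by
    rintro rfl
    rw [← ell_realVec, realVec, coordVec_zero'] at h
    simp [castVec, ell] at h
  set w : ℝ × ℂ := embW (realVec β) with hw
  have hw1 : w.1 = ellO β := rfl
  have hw2 : w.2 = cplxEmb (realVec β) := rfl
  have h1 : 0 < w.1 := h
  have h2 : w.2 ≠ 0 := embW_realVec_snd_ne_zero hβ
  set L : ℝ := Real.log (ellO β) / unitLog with hL
  have habs : |ellO β| = ellO β := abs_of_pos h
  -- `ν₀`
  have h0 : nu0O χ β = χ (toQuotMod q β) * Complex.exp ((-(charAngle χ * L) : ℝ) * I) := by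
    rw [nu0O, habs, div_self h.ne', Complex.ofReal_one, one_pow, mul_one]
  -- `ν₁`
  have hc : ((ellO β : ℂ) * cplxEmb (realVec β)) / (‖(ellO β : ℂ) * cplxEmb (realVec β)‖ : ℂ) =
      Complex.exp ((Complex.arg w.2 : ℂ) * I) := by
    have hne : (ellO β : ℂ) * cplxEmb (realVec β) ≠ 0 :=
      mul_ne_zero (Complex.ofReal_ne_zero.2 h.ne') (hw2 ▸ h2)
    have hn : (‖(ellO β : ℂ) * cplxEmb (realVec β)‖ : ℂ) ≠ 0 := by
      exact_mod_cast (norm_ne_zero_iff.2 hne)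
    rw [div_eq_iff hn, hw2, ← Complex.arg_real_mul (cplxEmb (realVec β)) h, mul_comm (Complex.exp _)]
    exact (Complex.norm_mul_exp_arg_mul_I _).symm
  have h1' : nu1O β = Complex.exp ((Complex.arg w.2 : ℂ) * I) * Complex.exp ((-(unitArg * L) : ℝ) * I) := by
    rw [nu1O, nu1, ell_realVec, hc, habs]
  -- `ν₂`
  have h2' : nu2O β = Complex.exp ((-(2 * Real.pi * L) : ℝ) * I) := by
    rw [nu2O, nu2, ell_realVec, habs]
  -- assemble the left side as `χ · exp(Z)`
  rw [nuO, h0, h1', h2', mul_zpow, ← Complex.exp_int_mul, ← Complex.exp_int_mul, ← Complex.exp_int_mul]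
  rw [charW, normTwist, log_div_unitLog_eq h1 h2 |>.symm.trans (by rw [hw1] : Real.log w.1 / unitLog = L) |>.symm]
  -- now both sides are products of exponentials
  have hπ : (Real.pi : ℂ) ≠ 0 := by exact_mod_cast Real.pi_ne_zero
  simp only [mul_assoc, ← Complex.exp_add]
  congr 1
  simp only [kappaOf]
  push_cast
  field_simp
  ring

/-! ### Non-zero ideals of norm `≤ N` and their canonical generators in `t·F` -/

open LFunctions.NumberField in
/-- The non-zero ideals of norm `≤ N`. [folklore] -/
def idealsUpTo (N : ℕ) : Finset (Ideal (𝓞 K)) := (Finset.Icc 1 N).biUnion (fun n ↦ idealsOfNorm K n)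

open LFunctions.NumberField in
/-- Membership in `idealsUpTo N`: `I ≠ 0` and `N(I) ≤ N`. [folklore] -/
theorem mem_idealsUpTo {N : ℕ} {I : Ideal (𝓞 K)} : I ∈ idealsUpTo N ↔ I ≠ ⊥ ∧ Ideal.absNorm I ≤ N := by
  rw [idealsUpTo, Finset.mem_biUnion]
  constructor
  · rintro ⟨n, hn, hI⟩
    rw [mem_idealsOfNorm] at hI
    rw [Finset.mem_Icc] at hn
    refine ⟨fun h ↦ ?_, hI ▸ hn.2⟩
    rw [h, Ideal.absNorm_bot] at hI; omega
  · rintro ⟨hI, hN⟩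
    refine ⟨Ideal.absNorm I, Finset.mem_Icc.2 ⟨Nat.one_le_iff_ne_zero.2 ?_, hN⟩, by rw [mem_idealsOfNorm]⟩
    exact Ideal.absNorm_eq_zero_iff.not.2 hI

open LFunctions.NumberField in
/-- Sums over `idealsUpTo N` are the partial sums of the norm-collected coefficients. [folklore] -/
theorem sum_idealsUpTo_eq (N : ℕ) (f : Ideal (𝓞 K) → ℂ) :
    ∑ I ∈ idealsUpTo N, f I = ∑ n ∈ Finset.Icc 1 N, ∑ I ∈ idealsOfNorm K n, f I := by
  rw [idealsUpTo, Finset.sum_biUnion]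
  intro m _ n _ hmn
  simp only [Function.onFun]
  rw [Finset.disjoint_left]
  intro I h1 h2
  rw [mem_idealsOfNorm] at h1 h2
  exact hmn (h1.symm.trans h2)

/-- **The canonical generators of the ideals of norm `≤ t³`** as integer vectors: the `v ∈ ℤ³` with
`embW v̂ ∈ t·F`. [cite: HeathBrownActa2001, §11 (11.3)] -/
def latticeGens (t : ℝ) : Finset (ℤ × ℤ × ℤ) :=
  (idealsUpTo ⌊t ^ 3⌋₊).image (fun I ↦ coordVec (canonGen I))

/-- `realVec (canonGen I)` written through `castVec`. [folklore] -/
theorem castVec_coordVec_canonGen (I : Ideal (𝓞 K)) : castVec (coordVec (canonGen I)) = realVec (canonGen I) := rfl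

/-- **Membership in `latticeGens t`** (`t > 0`): `v ∈ latticeGens t ↔ embW v̂ ∈ t • F`. [folklore] -/
theorem mem_latticeGens_iff {t : ℝ} (ht : 0 < t) {v : ℤ × ℤ × ℤ} :
    v ∈ latticeGens t ↔ embW (castVec v) ∈ t • sectorIoc ((0 : ℝ), -Real.pi) (1, Real.pi) := by
  rw [latticeGens, Finset.mem_image]
  constructor
  · rintro ⟨I, hI, rfl⟩
    rw [mem_idealsUpTo] at hI
    rw [castVec_coordVec_canonGen, embW_realVec_mem_smul_iff ht (canonGen_ne_zero hI.1), span_canonGen]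
    refine ⟨inWindow_canonGen hI.1, ?_⟩
    calc (Ideal.absNorm I : ℝ) ≤ ⌊t ^ 3⌋₊ := by exact_mod_cast hI.2
      _ ≤ t ^ 3 := Nat.floor_le (by positivity)
  · intro hv
    have hv' : embW (realVec (coordElt v)) ∈ t • sectorIoc ((0 : ℝ), -Real.pi) (1, Real.pi) := by
      rwa [realVec_coordElt]
    have hβ : coordElt v ≠ 0 := by
      intro h0
      rw [h0] at hv'
      have := (pos_of_mem_smul_fundRegion ht hv').1
      simp [realVec, castVec, ell] at this
    rw [embW_realVec_mem_smul_iff ht hβ] at hv'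
    refine ⟨Ideal.span {coordElt v}, ?_, ?_⟩
    · rw [mem_idealsUpTo]
      refine ⟨by rwa [Ne, Ideal.span_singleton_eq_bot], Nat.le_floor ?_⟩
      exact_mod_cast hv'.2
    · rw [canonGen_span_eq_of_inWindow hβ hv'.1, coordVec_coordElt]

/-- `I ↦ coordVec (canonGen I)` is injective on non-zero ideals. [folklore] -/
theorem injOn_coordVec_canonGen (N : ℕ) :
    Set.InjOn (fun I : Ideal (𝓞 K) ↦ coordVec (canonGen I)) (idealsUpTo N : Set (Ideal (𝓞 K))) := by
  intro I _ J _ h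
  have : canonGen I = canonGen J := by
    have := congrArg coordElt h
    simpa using this
  rw [← span_canonGen I, ← span_canonGen J, this]

/-- **Ideal sums as lattice sums**: `∑_{0 < N(I) ≤ t³} f(I) = ∑_{v ∈ latticeGens t} f((coordElt v))`.
[folklore] -/
theorem sum_idealsUpTo_eq_sum_latticeGens (t : ℝ) (f : Ideal (𝓞 K) → ℂ) :
    ∑ I ∈ idealsUpTo ⌊t ^ 3⌋₊, f I = ∑ v ∈ latticeGens t, f (Ideal.span {coordElt v}) := by
  rw [latticeGens, Finset.sum_image (injOn_coordVec_canonGen _)]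
  refine Finset.sum_congr rfl fun I _ ↦ ?_
  simp only [coordElt_coordVec, span_canonGen]

/-! ### Residue classes `mod q` on `ℤ³` -/

/-- The reduced representatives `{0, …, q−1}³ ⊂ ℤ³`. [folklore] -/
def reps (q : ℕ) : Finset (ℤ × ℤ × ℤ) :=
  (Finset.range q ×ˢ (Finset.range q ×ˢ Finset.range q)).image
    (fun a ↦ ((a.1 : ℤ), (a.2.1 : ℤ), (a.2.2 : ℤ)))

/-- `#reps q = q³`. [folklore] -/
theorem card_reps (q : ℕ) : (reps q).card = q ^ 3 := by
  rw [reps, Finset.card_image_of_injective, Finset.card_product, Finset.card_product, Finset.card_range]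
  · ring
  · intro a b h
    simp only [Prod.mk.injEq, Nat.cast_inj] at h
    exact Prod.ext h.1 (Prod.ext h.2.1 h.2.2)

/-- The reduction map `v ↦ v mod q ∈ reps q`. [folklore] -/
def redMod (q : ℕ) (v : ℤ × ℤ × ℤ) : ℤ × ℤ × ℤ := (v.1 % q, v.2.1 % q, v.2.2 % q)

/-- `redMod q v ∈ reps q` (`q ≥ 1`). [folklore] -/
theorem redMod_mem_reps {q : ℕ} (hq : 0 < q) (v : ℤ × ℤ × ℤ) : redMod q v ∈ reps q := by
  have hq' : (0 : ℤ) < q := by exact_mod_cast hq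
  have h : ∀ z : ℤ, ∃ n : ℕ, n < q ∧ (n : ℤ) = z % q := fun z ↦ by
    refine ⟨(z % q).toNat, ?_, ?_⟩
    · have := Int.emod_lt_of_pos z hq'
      have h0 := Int.emod_nonneg z hq'.ne'
      omega
    · exact Int.toNat_of_nonneg (Int.emod_nonneg z hq'.ne')
  obtain ⟨n₁, h₁, e₁⟩ := h v.1
  obtain ⟨n₂, h₂, e₂⟩ := h v.2.1
  obtain ⟨n₃, h₃, e₃⟩ := h v.2.2
  rw [reps, Finset.mem_image]
  refine ⟨(n₁, n₂, n₃), by simp [h₁, h₂, h₃], ?_⟩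
  simp [redMod, e₁, e₂, e₃]

/-- For a reduced representative `a`, `redMod q v = a ↔ v ≡ a (mod q)`. [folklore] -/
theorem redMod_eq_iff {q : ℕ} (hq : 0 < q) {a : ℤ × ℤ × ℤ} (ha : a ∈ reps q) (v : ℤ × ℤ × ℤ) :
    redMod q v = a ↔ CongMod q a v := by
  have hq' : (0 : ℤ) < q := by exact_mod_cast hq
  rw [reps, Finset.mem_image] at ha
  obtain ⟨⟨n₁, n₂, n₃⟩, hn, rfl⟩ := ha
  simp only [Finset.mem_product, Finset.mem_range] at hn
  have key : ∀ (z : ℤ) (n : ℕ), n < q → (z % q = n ↔ (q : ℤ) ∣ z - n) := by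
    intro z n hnq
    have hn : (n : ℤ) % q = n := Int.emod_eq_of_lt (by positivity) (by exact_mod_cast hnq)
    constructor
    · intro h
      have hmod : z ≡ n [ZMOD q] := by rw [Int.ModEq, h, hn]
      exact Int.modEq_iff_dvd.1 hmod.symm
    · intro h
      have hmod := (Int.modEq_iff_dvd.2 h).symm
      rw [Int.ModEq] at hmod
      rw [hmod, hn]
  simp only [redMod, CongMod, Prod.mk.injEq]
  rw [key _ _ hn.1, key _ _ hn.2.1, key _ _ hn.2.2]

/-- **Splitting a lattice sum into residue classes `mod q`.** [folklore] -/
theorem sum_eq_sum_reps_filter {q : ℕ} (hq : 0 < q) (T : Finset (ℤ × ℤ × ℤ)) (h : (ℤ × ℤ × ℤ) → ℂ) :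
    ∑ v ∈ T, h v = ∑ a ∈ reps q, ∑ v ∈ T.filter (fun v ↦ CongMod q a v), h v := by
  classical
  rw [← Finset.sum_fiberwise_of_maps_to (g := redMod q) (fun v _ ↦ redMod_mem_reps hq v)]
  refine Finset.sum_congr rfl fun a ha ↦ ?_
  refine Finset.sum_congr ?_ fun _ _ ↦ rfl
  ext v
  simp only [Finset.mem_filter, redMod_eq_iff hq ha]

/-- The class filter of `latticeGens t` has the membership required by the twisted-sum theorems.
[folklore] -/
theorem mem_filter_latticeGens_iff {t : ℝ} (ht : 0 < t) (q : ℕ) (a v : ℤ × ℤ × ℤ) :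
    v ∈ (latticeGens t).filter (fun v ↦ CongMod q a v) ↔
      CongMod q a v ∧ embW (castVec v) ∈ t • sectorIoc ((0 : ℝ), -Real.pi) (1, Real.pi) := by
  rw [Finset.mem_filter, mem_latticeGens_iff ht, and_comm]

/-! ### The residue character is a class function; `reps q ≃ 𝓞_K/(q)` -/

/-- `v ≡ a (mod q)` coordinatewise gives `coordElt v ≡ coordElt a (mod q)` in `𝓞_K/(q)`. [folklore] -/
theorem toQuotMod_coordElt_eq {q : ℕ} {a v : ℤ × ℤ × ℤ} (h : CongMod q a v) :
    toQuotMod q (coordElt v) = toQuotMod q (coordElt a) := by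
  rw [toQuotMod, Ideal.Quotient.eq, Ideal.mem_span_singleton, ← coordElt_sub, natCast_dvd_coordElt_iff]
  exact h

/-- `a ↦ coordElt a mod q` is injective on the reduced representatives. [folklore] -/
theorem injOn_toQuotMod_coordElt {q : ℕ} (hq : 0 < q) :
    Set.InjOn (fun a : ℤ × ℤ × ℤ ↦ toQuotMod q (coordElt a)) (reps q : Set (ℤ × ℤ × ℤ)) := by
  intro a ha b hb h
  simp only at h
  rw [toQuotMod, Ideal.Quotient.eq, Ideal.mem_span_singleton, ← coordElt_sub, natCast_dvd_coordElt_iff] at h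
  rw [Finset.mem_coe, reps, Finset.mem_image] at ha hb
  obtain ⟨⟨m₁, m₂, m₃⟩, hm, rfl⟩ := ha
  obtain ⟨⟨n₁, n₂, n₃⟩, hn, rfl⟩ := hb
  simp only [Finset.mem_product, Finset.mem_range] at hm hn
  simp only at h
  have key : ∀ m n : ℕ, m < q → n < q → (q : ℤ) ∣ (m : ℤ) - n → m = n := by
    intro m n hm hn hd
    obtain ⟨c, hc⟩ := hd
    have h1 : ((m : ℤ) - n) < q := by omega
    have h2 : -(q : ℤ) < (m : ℤ) - n := by omega
    have hc0 : c = 0 := by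
      by_contra hne
      rcases lt_or_gt_of_ne hne with hlt | hgt
      · have : (q : ℤ) * c ≤ (q : ℤ) * (-1) := by apply mul_le_mul_of_nonneg_left (by omega) (by omega)
        omega
      · have : (q : ℤ) * 1 ≤ (q : ℤ) * c := by apply mul_le_mul_of_nonneg_left (by omega) (by omega)
        omega
    rw [hc0, mul_zero, sub_eq_zero] at hc
    exact_mod_cast hc
  have e1 := key _ _ hm.1 hn.1 h.1
  have e2 := key _ _ hm.2.1 hn.2.1 h.2.1
  have e3 := key _ _ hm.2.2 hn.2.2 h.2.2
  subst e1; subst e2; subst e3; rfl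

/-- Every residue class of `𝓞_K/(q)` has a reduced representative `coordElt a`, `a ∈ reps q`. [folklore] -/
theorem exists_reps_toQuotMod_eq {q : ℕ} (hq : 0 < q) (x : QuotMod q) :
    ∃ a ∈ reps q, toQuotMod q (coordElt a) = x := by
  obtain ⟨β, rfl⟩ := Ideal.Quotient.mk_surjective x
  refine ⟨redMod q (coordVec β), redMod_mem_reps hq _, ?_⟩
  have h : CongMod q (redMod q (coordVec β)) (coordVec β) :=
    (redMod_eq_iff hq (redMod_mem_reps hq _) _).1 rfl
  have := toQuotMod_coordElt_eq h
  rw [coordElt_coordVec] at this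
  exact this.symm

/-- **`∑_{a ∈ reps q} χ(coordElt a) = 0` for a non-principal character `χ` of `(𝓞_K/(q))^×`**
(orthogonality, through the bijection `reps q ≃ 𝓞_K/(q)`). [folklore] -/
theorem sum_reps_mulChar_eq_zero {q : ℕ} (hq : 1 ≤ q) {χ : MulChar (QuotMod q) ℂ} (hχ : χ ≠ 1) :
    ∑ a ∈ reps q, χ (toQuotMod q (coordElt a)) = 0 := by
  classical
  haveI : Finite (QuotMod q) := finite_quotMod hq
  letI : Fintype (QuotMod q) := Fintype.ofFinite _
  have hq0 : 0 < q := hq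
  have h := MulChar.sum_eq_zero_of_ne_one hχ
  rw [← h]
  refine Finset.sum_nbij (fun a ↦ toQuotMod q (coordElt a)) (fun _ _ ↦ Finset.mem_univ _)
    (injOn_toQuotMod_coordElt hq0) ?_ (fun _ _ ↦ rfl)
  intro x _
  obtain ⟨a, ha, hax⟩ := exists_reps_toQuotMod_eq hq0 x
  exact ⟨a, ha, hax⟩

/-! ### The untwisted partial sums of `ν^{(j,k)}` -/

/-- **The phase `n^{iΘ} = exp(iΘ log n)`.** [folklore] -/
def normPhase (Θ : ℝ) (n : ℕ) : ℂ := Complex.exp (((Θ * Real.log n : ℝ)) * I)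

/-- `|n^{iΘ}| = 1`. [folklore] -/
theorem norm_normPhase (Θ : ℝ) (n : ℕ) : ‖normPhase Θ n‖ = 1 := by
  rw [normPhase, Complex.norm_exp_ofReal_mul_I]

/-- **The norm frequency** `Θ = 2πκ/(3 log ε)` of `ν^{(j,k)}`: `ν(β) = χ(β)ψ_{j,κ}(β̂)N(β)^{−iΘ}`.
[cite: HeathBrownActa2001, §9 (9.2)] -/
def thetaOf (χ : MulChar (QuotMod q) ℂ) (j k : ℤ) : ℝ := 2 * Real.pi * kappaOf χ j k / (3 * unitLog)

/-- The norm twist of `ν` at `β > 0` is `N((β))^{−iΘ}`: `normTwist κ (embW β̂) · N^{iΘ} = 1`. [folklore] -/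
theorem normTwist_mul_normPhase (χ : MulChar (QuotMod q) ℂ) (j k : ℤ) {β : 𝓞 K} (h : 0 < ellO β) :
    normTwist (kappaOf χ j k) (embW (realVec β)) *
      normPhase (thetaOf χ j k) (Ideal.absNorm (Ideal.span {β})) = 1 := by
  rw [normTwist, normPhase, ← Complex.exp_add, wNorm_embW_realVec h]
  convert Complex.exp_zero using 2
  rw [thetaOf]
  push_cast
  field_simp
  ring

/-- **The value of `ν^{(j,k)} · N^{iΘ}` at the ideal of a canonical generator**: for `v ∈ latticeGens t`,
`ν((coordElt v)) · N^{iΘ} = χ(coordElt v) · ψ_{j,κ}(embW v̂)`. [cite: HeathBrownActa2001, §9 (9.2)] -/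
theorem grossenChar_mul_normPhase_eq {q : ℕ} (hq : 1 ≤ q) (χ : MulChar (QuotMod q) ℂ) (j k : ℤ)
    {t : ℝ} (ht : 0 < t) {v : ℤ × ℤ × ℤ} (hv : v ∈ latticeGens t) :
    grossenChar hq χ j k (Ideal.span {coordElt v}) *
        normPhase (thetaOf χ j k) (Ideal.absNorm (Ideal.span {coordElt v})) =
      χ (toQuotMod q (coordElt v)) * charW j (kappaOf χ j k) (embW (castVec v)) := by
  rw [mem_latticeGens_iff ht] at hv
  have hpos := (pos_of_mem_smul_fundRegion ht hv).1
  have hell : 0 < ellO (coordElt v) := by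
    rw [← ell_realVec, realVec_coordElt]; exact hpos
  have hβ : coordElt v ≠ 0 := by
    rintro h0
    rw [h0, ← ell_realVec, realVec, coordVec_zero'] at hell
    simp [castVec, ell] at hell
  have haux : normTwist (kappaOf χ j k) (embW (castVec v)) *
      normPhase (thetaOf χ j k) (Ideal.absNorm (Ideal.span {coordElt v})) = 1 := by
    have := normTwist_mul_normPhase χ j k hell
    rwa [realVec_coordElt] at this
  rw [grossenChar_span hq χ j k hβ, ← nuO, nuO_eq_charW χ j k hell, realVec_coordElt, mul_assoc, haux,
    mul_one]

/-- **The untwisted partial sum of `ν^{(j,k)}` as a character-weighted sum of class sums.**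
`∑_{0<N(I)≤t³} ν(I)N(I)^{iΘ} = ∑_{a ∈ reps q} χ(coordElt a) ∑_{v ∈ T(a)} ψ_{j,κ}(embW v̂)`.
[cite: HeathBrownActa2001, §9 (9.2)] -/
theorem sum_grossenChar_mul_normPhase_eq {q : ℕ} (hq : 1 ≤ q) (χ : MulChar (QuotMod q) ℂ) (j k : ℤ)
    {t : ℝ} (ht : 0 < t) :
    ∑ I ∈ idealsUpTo ⌊t ^ 3⌋₊, grossenChar hq χ j k I * normPhase (thetaOf χ j k) (Ideal.absNorm I) =
      ∑ a ∈ reps q, χ (toQuotMod q (coordElt a)) *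
        ∑ v ∈ (latticeGens t).filter (fun v ↦ CongMod q a v), charW j (kappaOf χ j k) (embW (castVec v)) := by
  rw [sum_idealsUpTo_eq_sum_latticeGens t
    (fun I ↦ grossenChar hq χ j k I * normPhase (thetaOf χ j k) (Ideal.absNorm I))]
  rw [Finset.sum_congr rfl (fun v hv ↦ grossenChar_mul_normPhase_eq hq χ j k ht hv),
    sum_eq_sum_reps_filter hq (latticeGens t)]
  refine Finset.sum_congr rfl fun a _ ↦ ?_
  rw [Finset.mul_sum]
  refine Finset.sum_congr rfl fun v hv ↦ ?_
  rw [Finset.mem_filter] at hv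
  rw [toQuotMod_coordElt_eq hv.2]

/-- `|χ(x)| ≤ 1` for a character of the finite ring `𝓞_K/(q)`. [folklore] -/
theorem norm_mulChar_le_one {q : ℕ} (hq : 1 ≤ q) (χ : MulChar (QuotMod q) ℂ) (x : QuotMod q) : ‖χ x‖ ≤ 1 := by
  by_cases hx : IsUnit x
  · obtain ⟨u, rfl⟩ := hx
    exact (norm_mulChar_apply_units hq χ u).le
  · rw [MulChar.map_nonunit χ hx, norm_zero]; exact zero_le_one

/-- **Non-triviality of `ν^{(j,k)}` in terms of the parameters**: if `ν^{(j,k)}` is not trivial `mod q`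
then `χ ≠ χ₀`, or `j ≠ 0`, or `κ = k ≠ 0`. [cite: HeathBrownActa2001, §9 p. 54] -/
theorem params_of_not_isTrivialMod {q : ℕ} (hq : 1 ≤ q) {χ : MulChar (QuotMod q) ℂ} {j k : ℤ}
    (h : ¬ IsTrivialMod q (grossenChar hq χ j k)) :
    χ ≠ 1 ∨ j ≠ 0 ∨ (∃ k' : ℤ, (k' : ℝ) = kappaOf χ j k ∧ k' ≠ 0) := by
  by_contra hcon
  push Not at hcon
  obtain ⟨hχ, hj, hk⟩ := hcon
  have hκ : kappaOf χ j k = k := by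
    rw [kappaOf, hχ, charAngle_one, hj]; simp
  have hk0 : k = 0 := hk k (by rw [hκ])
  subst hχ; subst hj; subst hk0
  exact h (isTrivialMod_grossenChar_one hq)

/-- **Partial sums of a non-trivial `ν^{(j,k)}`, untwisted by `N^{iΘ}`, are `O(q³(1+|j|+|k|) x^{8/9})`**
(`x = t³`): the analytic input replacing Hecke's theory of Grössencharakter `L`-functions in the
continuation of `L(s, ν)` to `σ > 8/9` (via `LSeriesContinuationOfPartialSums`). Residue classes with
`χ ≠ χ₀` cancel by orthogonality against the class-independent main term
(`exists_twisted_sum_approx`); otherwise the torus character is non-trivial on every class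
(`exists_twisted_sum_bound`). [cite: HeathBrownActa2001, §9 Lemma 9.4 (input); Mitsui1956, Lemma 5] -/
theorem exists_grossenChar_partialSum_bound :
    ∃ C : ℝ, ∀ (q : ℕ) (hq : 1 ≤ q) (χ : MulChar (QuotMod q) ℂ) (j k : ℤ),
      ¬ IsTrivialMod q (grossenChar hq χ j k) → ∀ t : ℝ, 1 ≤ t →
        ‖∑ I ∈ idealsUpTo ⌊t ^ 3⌋₊, grossenChar hq χ j k I * normPhase (thetaOf χ j k) (Ideal.absNorm I)‖ ≤
          C * (q : ℝ) ^ 3 * (1 + |(j : ℝ)| + |(k : ℝ)|) * t ^ (8 / 3 : ℝ) := by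
  obtain ⟨C_A, hA⟩ := exists_twisted_sum_approx
  obtain ⟨C_B, hB⟩ := exists_twisted_sum_bound
  set C : ℝ := max (max C_A C_B) 0 with hC
  have hC0 : 0 ≤ C := le_max_right _ _
  have hCA : C_A ≤ C := (le_max_left _ _).trans (le_max_left _ _)
  have hCB : C_B ≤ C := (le_max_right _ _).trans (le_max_left _ _)
  refine ⟨2 * C, fun q hq χ j k hν t ht ↦ ?_⟩
  have hq0 : 0 < q := hq
  have ht0 : 0 < t := by linarith
  set κ := kappaOf χ j k with hκ
  have hJ : 1 + |(j : ℝ)| + |κ| ≤ 2 * (1 + |(j : ℝ)| + |(k : ℝ)|) := by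
    have := abs_kappaOf_le χ j k
    rw [← hκ] at this
    linarith [abs_nonneg (j : ℝ), abs_nonneg (k : ℝ)]
  have ht8 : 0 < t ^ (8 / 3 : ℝ) := Real.rpow_pos_of_pos ht0 _
  rw [sum_grossenChar_mul_normPhase_eq hq χ j k ht0]
  set S : (ℤ × ℤ × ℤ) → ℂ := fun a ↦
    ∑ v ∈ (latticeGens t).filter (fun v ↦ CongMod q a v), charW j κ (embW (castVec v)) with hS
  have hspec : ∀ a v, v ∈ (latticeGens t).filter (fun v ↦ CongMod q a v) ↔
      CongMod q a v ∧ embW (castVec v) ∈ t • sectorIoc ((0 : ℝ), -Real.pi) (1, Real.pi) :=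
    fun a v ↦ mem_filter_latticeGens_iff ht0 q a v
  -- the per-class bound `‖χ(a)(S a - R)‖ ≤ C (1+|j|+|κ|) t^{8/3}` summed over `q³` classes
  have hsum_le : ∀ R : ℂ, (∀ a, ‖S a - R‖ ≤ C * (1 + |(j : ℝ)| + |κ|) * t ^ (8 / 3 : ℝ)) →
      ‖∑ a ∈ reps q, χ (toQuotMod q (coordElt a)) * (S a - R)‖ ≤
        2 * C * (q : ℝ) ^ 3 * (1 + |(j : ℝ)| + |(k : ℝ)|) * t ^ (8 / 3 : ℝ) := by
    intro R hR
    calc ‖∑ a ∈ reps q, χ (toQuotMod q (coordElt a)) * (S a - R)‖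
        ≤ ∑ a ∈ reps q, ‖χ (toQuotMod q (coordElt a)) * (S a - R)‖ := norm_sum_le _ _
      _ ≤ ∑ a ∈ reps q, C * (1 + |(j : ℝ)| + |κ|) * t ^ (8 / 3 : ℝ) := by
          refine Finset.sum_le_sum fun a _ ↦ ?_
          rw [norm_mul]
          calc ‖χ (toQuotMod q (coordElt a))‖ * ‖S a - R‖ ≤ 1 * (C * (1 + |(j : ℝ)| + |κ|) * t ^ (8 / 3 : ℝ)) :=
                mul_le_mul (norm_mulChar_le_one hq χ _) (hR a) (norm_nonneg _) zero_le_one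
            _ = _ := one_mul _
      _ = (q : ℝ) ^ 3 * (C * (1 + |(j : ℝ)| + |κ|) * t ^ (8 / 3 : ℝ)) := by
          rw [Finset.sum_const, card_reps, nsmul_eq_mul]; push_cast; ring
      _ ≤ (q : ℝ) ^ 3 * (C * (2 * (1 + |(j : ℝ)| + |(k : ℝ)|)) * t ^ (8 / 3 : ℝ)) := by
          gcongr
      _ = _ := by ring
  rcases params_of_not_isTrivialMod hq hν with hχ | hjk
  · -- `χ ≠ χ₀`: orthogonality against the class-independent main term
    obtain ⟨R, hR⟩ := hA j κ q hq0 t ht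
    have hzero : ∑ a ∈ reps q, χ (toQuotMod q (coordElt a)) * R = 0 := by
      rw [← Finset.sum_mul, sum_reps_mulChar_eq_zero hq hχ, zero_mul]
    have hrw : ∑ a ∈ reps q, χ (toQuotMod q (coordElt a)) * S a =
        ∑ a ∈ reps q, χ (toQuotMod q (coordElt a)) * (S a - R) := by
      simp only [mul_sub, Finset.sum_sub_distrib, hzero, sub_zero]
    rw [hrw]
    refine hsum_le R fun a ↦ (hR a _ (hspec a)).trans ?_
    gcongr
  · -- the torus character is non-trivial on every class
    have hrw : ∑ a ∈ reps q, χ (toQuotMod q (coordElt a)) * S a =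
        ∑ a ∈ reps q, χ (toQuotMod q (coordElt a)) * (S a - 0) := by simp only [sub_zero]
    rw [hrw]
    refine hsum_le 0 fun a ↦ ?_
    rw [sub_zero]
    refine (hB j κ hjk q hq0 a t ht _ (hspec a)).trans ?_
    gcongr
end Literature.NumberTheory.Sieve.CubicSieve
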